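import Mathlib
import Summits.KontsevichZagierPeriods.Zeta5Search.WedgeDictionaryClosing
import Summits.KontsevichZagierPeriods.Zeta5Search.WedgeDictionaryAnchor
import Summits.KontsevichZagierPeriods.Zeta5Search.WedgeDictionaryFull
import HarnessLib

/-!
# The wedge dictionary for EVERY partner direction: the partner condition removed; `wedgeDictionaryFull` reduced to its
# off-half-box points (cell `pub-zeta5`, seat ct-1 g22)

HONEST FRAMING: systematic search; no irrationality claim unless certified.  Identities among the cell's closed forms `U, W, V`
(`DualSeries.coeffU/W/V`) and Brown–Zudilin's absolutely convergent cellular integrals on the dictionary's region; no new value, no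
`γ`, nothing about `ζ(5)`; no `def`, no new node.

The tree's `WedgeDictionary.explicitPQ` / `wedgeDictionary` (THEOREMS since ct-1 g21's `WedgeDictionaryClosing`) carry, besides the
region `0 ≤ 2b_i ≤ b₀ + 1`, `d ≥ 0`, the PARTNER CONDITION `2(b_j + 1) ≤ b₀ + 1` on the contiguous direction `e_j` in which the wedge
`b ∧ (b + e_j)` is taken (STATEMENT.md, applicability row `hpart`).  It is superfluous:

* `wedgeMinors_partner_indep` — by the tree's contiguity `coeff_update_sub`
  (`X(b+e_i) − X(b+e_k) = (b_i − b_k)(b₀ − b_i − b_k)·X(b)`, `X ∈ {U, W, V}`) the three wedge minors `UV′ − U′V`, `W′V − WV′`,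
  `UW′ − U′W` do NOT depend on the partner (box `InBox b`, `d ≥ 0`, `b_i, b_k ≤ b₀`); hence `dictPhat`, `dictP` and `ExplicitPQAt a ·`
  are partner-independent (`dictPhat_partner_indep`, `dictP_partner_indep`, `explicitPQAt_partner_indep`);
* `explicitPQAt_allPartners` — `ExplicitPQAt a j` for EVERY `j ∈ [1,7]` at every region point (one admissible partner always exists,
  except at `a = 0⁸`, where the diagonal theorem `explicitPQAt_aDiag` applies); `explicitPQ_allPartners`, `wedgeDictionary_allPartners` —
  the two dictionary statements verbatim with the partner hypothesis deleted;
* `wedgeDictionaryFull_iff_offHalfBox` — typer g3's wide-region node `wedgeDictionaryFull` (`b_i ≥ 0`, `d ≥ 0`, any partner) is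
  EQUIVALENT to its restriction to the points with some `2b_i > b₀ + 1`: that residual (off the half box) is the open part and is NOT
  proved here.
-/

noncomputable section

open Finset

namespace Summit.KontsevichZagierPeriods.Zeta5Search.WedgeDictionaryAllPartners

open Summit.KontsevichZagierPeriods.Zeta5Search.WedgeDictionary
open Summit.KontsevichZagierPeriods.Zeta5Search.WedgeDictionaryClosing (explicitPQ_holds wedgeDictionary_holds I_init_holds
  I_solvesRec_holds)
open Summit.KontsevichZagierPeriods.Zeta5Search.DualSeries
open Literature.NumberTheory.Irrationality.BrownZudilin2022
open Literature.NumberTheory.Transcendental (zetaValue)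

/-! ## 1. The wedge minors do not depend on the partner -/

/-- **Partner independence of the three wedge minors**: for `b` in the box with `d(b) ≥ 0` and two partner slots `i+1`, `k+1`
with `b_{i+1}, b_{k+1} ≤ b₀`, the minors `U(b)V(b′) − U(b′)V(b)`, `W(b′)V(b) − W(b)V(b′)`, `U(b)W(b′) − U(b′)W(b)` are the same for
`b′ = b + e_{i+1}` and `b′ = b + e_{k+1}` (from `coeff_update_sub`). [folklore] -/
theorem wedgeMinors_partner_indep (b : ℕ → ℤ) (hb : InBox b) (hd : 0 ≤ dOf b) {i k : ℕ} (hi : i ∈ range 7)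
    (hk : k ∈ range 7) (hli : b (i + 1) ≤ b 0) (hlk : b (k + 1) ≤ b 0) :
    coeffU b * coeffV (Function.update b (i + 1) (b (i + 1) + 1)) - coeffU (Function.update b (i + 1) (b (i + 1) + 1)) * coeffV b =
        coeffU b * coeffV (Function.update b (k + 1) (b (k + 1) + 1)) -
          coeffU (Function.update b (k + 1) (b (k + 1) + 1)) * coeffV b ∧
      coeffW (Function.update b (i + 1) (b (i + 1) + 1)) * coeffV b - coeffW b * coeffV (Function.update b (i + 1) (b (i + 1) + 1)) =
        coeffW (Function.update b (k + 1) (b (k + 1) + 1)) * coeffV b -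
          coeffW b * coeffV (Function.update b (k + 1) (b (k + 1) + 1)) ∧
      coeffU b * coeffW (Function.update b (i + 1) (b (i + 1) + 1)) - coeffU (Function.update b (i + 1) (b (i + 1) + 1)) * coeffW b =
        coeffU b * coeffW (Function.update b (k + 1) (b (k + 1) + 1)) -
          coeffU (Function.update b (k + 1) (b (k + 1) + 1)) * coeffW b := by
  obtain ⟨hU, hW, hV⟩ := coeff_update_sub b hb hd hi hk hli hlk
  refine ⟨?_, ?_, ?_⟩
  · linear_combination (coeffU b) * hV - (coeffV b) * hU
  · linear_combination (coeffV b) * hW - (coeffW b) * hV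
  · linear_combination (coeffU b) * hW - (coeffW b) * hU

/-- On the dictionary's region (`0 ≤ b_i`, `2b_i ≤ b₀ + 1` for `i ∈ [1,7]`) of a CONVERGENT `a`, the dual vector `b(a)` lies in the box
and every slot is `≤ b₀` (`b₀ = a₂ + a₃ + a₄ ≥ 0` by three convergence forms). [folklore] -/
theorem inBox_of_region_converges {a : Fin 8 → ℤ} (hconv : Converges a)
    (hreg : ∀ i ∈ Icc 1 7, 0 ≤ bOfA a i ∧ 2 * bOfA a i ≤ bOfA a 0 + 1) :
    InBox (bOfA a) ∧ ∀ i ∈ Icc 1 7, bOfA a i ≤ bOfA a 0 := by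
  have hf : ∀ x ∈ convergenceForms a, 0 ≤ x := hconv
  have h1 : 0 ≤ a 1 := hf _ (by simp [convergenceForms])
  have h2 : 0 ≤ a 2 := hf _ (by simp [convergenceForms])
  have h3 : 0 ≤ a 3 := hf _ (by simp [convergenceForms])
  have h0 : 0 ≤ bOfA a 0 := by simp only [bOfA]; omega
  refine ⟨⟨h0, fun i hi => ?_⟩, fun i hi => ?_⟩
  · have h := hreg (i + 1) (by have := mem_range.1 hi; exact mem_Icc.2 ⟨by omega, by omega⟩)
    exact ⟨h.1, by omega⟩
  · have h := hreg i hi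
    omega

/-- `dictPhat a j` does not depend on the partner `j ∈ [1,7]` (region point of a convergent `a`, `d ≥ 0`). [folklore] -/
theorem dictPhat_partner_indep {a : Fin 8 → ℤ} (hconv : Converges a)
    (hreg : ∀ i ∈ Icc 1 7, 0 ≤ bOfA a i ∧ 2 * bOfA a i ≤ bOfA a 0 + 1) (hd : 0 ≤ dOf (bOfA a))
    {j k : ℕ} (hj : j ∈ Icc 1 7) (hk : k ∈ Icc 1 7) : dictPhat a j = dictPhat a k := by
  obtain ⟨hbox, hle⟩ := inBox_of_region_converges hconv hreg
  obtain ⟨i, rfl⟩ : ∃ i, j = i + 1 := ⟨j - 1, by have := (mem_Icc.1 hj).1; omega⟩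
  obtain ⟨l, rfl⟩ : ∃ l, k = l + 1 := ⟨k - 1, by have := (mem_Icc.1 hk).1; omega⟩
  have hi : i ∈ range 7 := by have := (mem_Icc.1 hj).2; exact mem_range.2 (by omega)
  have hl : l ∈ range 7 := by have := (mem_Icc.1 hk).2; exact mem_range.2 (by omega)
  unfold dictPhat
  rw [(wedgeMinors_partner_indep (bOfA a) hbox hd hi hl (hle _ hj) (hle _ hk)).1]

/-- `dictP a j` does not depend on the partner `j ∈ [1,7]` (region point of a convergent `a`, `d ≥ 0`). [folklore] -/
theorem dictP_partner_indep {a : Fin 8 → ℤ} (hconv : Converges a)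
    (hreg : ∀ i ∈ Icc 1 7, 0 ≤ bOfA a i ∧ 2 * bOfA a i ≤ bOfA a 0 + 1) (hd : 0 ≤ dOf (bOfA a))
    {j k : ℕ} (hj : j ∈ Icc 1 7) (hk : k ∈ Icc 1 7) : dictP a j = dictP a k := by
  obtain ⟨hbox, hle⟩ := inBox_of_region_converges hconv hreg
  obtain ⟨i, rfl⟩ : ∃ i, j = i + 1 := ⟨j - 1, by have := (mem_Icc.1 hj).1; omega⟩
  obtain ⟨l, rfl⟩ : ∃ l, k = l + 1 := ⟨k - 1, by have := (mem_Icc.1 hk).1; omega⟩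
  have hi : i ∈ range 7 := by have := (mem_Icc.1 hj).2; exact mem_range.2 (by omega)
  have hl : l ∈ range 7 := by have := (mem_Icc.1 hk).2; exact mem_range.2 (by omega)
  unfold dictP
  rw [(wedgeMinors_partner_indep (bOfA a) hbox hd hi hl (hle _ hj) (hle _ hk)).2.1]

/-- `ExplicitPQAt a j ↔ ExplicitPQAt a k` for any two partners `j, k ∈ [1,7]` (region point of a convergent `a`, `d ≥ 0`). [folklore] -/
theorem explicitPQAt_partner_indep {a : Fin 8 → ℤ} (hconv : Converges a)
    (hreg : ∀ i ∈ Icc 1 7, 0 ≤ bOfA a i ∧ 2 * bOfA a i ≤ bOfA a 0 + 1) (hd : 0 ≤ dOf (bOfA a))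
    {j k : ℕ} (hj : j ∈ Icc 1 7) (hk : k ∈ Icc 1 7) : ExplicitPQAt a j ↔ ExplicitPQAt a k := by
  unfold ExplicitPQAt
  rw [dictPhat_partner_indep hconv hreg hd hj hk, dictP_partner_indep hconv hreg hd hj hk]

/-! ## 2. The dictionary at every region point, for every partner -/

/-- The only region point (`0 ≤ 2b_i ≤ b₀ + 1`, `d ≥ 0`) WITHOUT an admissible partner (`2(b_j + 1) ≤ b₀ + 1` for no `j ∈ [1,7]`)
is `a = 0⁸` (then `2b_j ≥ b₀` for all `j` and `d = 3b₀ − Σ b_j ≥ 0` force `b = 0`). [folklore] -/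
theorem eq_zero_of_no_partner {a : Fin 8 → ℤ}
    (hreg : ∀ i ∈ Icc 1 7, 0 ≤ bOfA a i ∧ 2 * bOfA a i ≤ bOfA a 0 + 1) (hd : 0 ≤ dOf (bOfA a))
    (hnp : ¬ ∃ j ∈ Icc 1 7, 2 * (bOfA a j + 1) ≤ bOfA a 0 + 1) : a = SymRay.aDiag 0 := by
  have r1 := hreg 1 (by simp); have r2 := hreg 2 (by simp); have r3 := hreg 3 (by simp); have r4 := hreg 4 (by simp)
  have r5 := hreg 5 (by simp); have r6 := hreg 6 (by simp); have r7 := hreg 7 (by simp)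
  have hn : ∀ j ∈ Icc 1 7, ¬ 2 * (bOfA a j + 1) ≤ bOfA a 0 + 1 := fun j hj hle => hnp ⟨j, hj, hle⟩
  have n1 := hn 1 (by simp); have n2 := hn 2 (by simp); have n3 := hn 3 (by simp); have n4 := hn 4 (by simp)
  have n5 := hn 5 (by simp); have n6 := hn 6 (by simp); have n7 := hn 7 (by simp)
  unfold dOf at hd
  simp only [sum_range_succ, sum_range_zero] at hd
  norm_num at hd
  simp only [bOfA] at r1 r2 r3 r4 r5 r6 r7 n1 n2 n3 n4 n5 n6 n7 hd
  funext i
  simp only [SymRay.aDiag, Nat.cast_zero]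
  fin_cases i <;> simp <;> omega

/-- **`ExplicitPQAt a j` for EVERY partner `j ∈ [1,7]`** at every region point of a convergent `a` with `d ≥ 0` — gen-1's dictionary
identity `I(a) = Q(a)θ − 4P̂_d(a)ζ(2) − 2P_d(a)` with the partner condition removed. [folklore] -/
theorem explicitPQAt_allPartners {a : Fin 8 → ℤ} (hconv : Converges a)
    (hreg : ∀ i ∈ Icc 1 7, 0 ≤ bOfA a i ∧ 2 * bOfA a i ≤ bOfA a 0 + 1) (hd : 0 ≤ dOf (bOfA a))
    {j : ℕ} (hj : j ∈ Icc 1 7) : ExplicitPQAt a j := by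
  by_cases h : ∃ k ∈ Icc 1 7, 2 * (bOfA a k + 1) ≤ bOfA a 0 + 1
  · obtain ⟨k, hk, hpart⟩ := h
    have e : ExplicitPQAt a k := explicitPQ_iff_at.1 explicitPQ_holds a k ⟨hk, hconv, hreg, hd, hpart⟩
    exact (explicitPQAt_partner_indep hconv hreg hd hj hk).2 e
  · have ha : a = SymRay.aDiag 0 := eq_zero_of_no_partner hreg hd h
    subst ha
    have e : ExplicitPQAt (SymRay.aDiag 0) 1 := explicitPQAt_aDiag I_solvesRec_holds I_init_holds 0
    exact (explicitPQAt_partner_indep hconv hreg hd hj (by simp)).2 e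

/-- **`explicitPQ` with the partner condition deleted**: for every convergent `a` with `b(a)` in the half box and `d ≥ 0`, and EVERY
`j ∈ [1,7]`, `I(a) = Q(a)(2ζ(5) + 4ζ(3)ζ(2)) − 4ρ(UV′ − U′V)ζ(2) − 2ρ(W′V − WV′)`, `b′ = b + e_j`. [folklore] -/
theorem explicitPQ_allPartners :
    ∀ (a : Fin 8 → ℤ) (j : ℕ), j ∈ Icc 1 7 → Converges a →
      (∀ i ∈ Icc 1 7, 0 ≤ bOfA a i ∧ 2 * bOfA a i ≤ bOfA a 0 + 1) → 0 ≤ dOf (bOfA a) →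
      cellularIntegral a =
        (QOf a : ℝ) * (2 * zetaValue 5 + 4 * zetaValue 3 * zetaValue 2) -
          4 * ((rhoOf a * (coeffU (bOfA a) * coeffV (Function.update (bOfA a) j (bOfA a j + 1)) -
                coeffU (Function.update (bOfA a) j (bOfA a j + 1)) * coeffV (bOfA a)) : ℚ) : ℝ) * zetaValue 2 -
          2 * ((rhoOf a * (coeffW (Function.update (bOfA a) j (bOfA a j + 1)) * coeffV (bOfA a) -
                coeffW (bOfA a) * coeffV (Function.update (bOfA a) j (bOfA a j + 1))) : ℚ) : ℝ) := by
  intro a j hj hconv hreg hd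
  have e := explicitPQAt_allPartners hconv hreg hd hj
  unfold ExplicitPQAt dictPhat dictP at e
  exact e

/-- **The `Q`-half for every partner**: `Q(a) = ρ(a)·(U(b)W(b′) − U(b′)W(b))`, `b′ = b + e_j`, for EVERY `j ∈ [1,7]` at every region
point of a convergent `a` with `d ≥ 0`. [folklore] -/
theorem wedgeDictionary_Q_allPartners {a : Fin 8 → ℤ} (hconv : Converges a)
    (hreg : ∀ i ∈ Icc 1 7, 0 ≤ bOfA a i ∧ 2 * bOfA a i ≤ bOfA a 0 + 1) (hd : 0 ≤ dOf (bOfA a))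
    {j : ℕ} (hj : j ∈ Icc 1 7) :
    (QOf a : ℚ) = rhoOf a * (coeffU (bOfA a) * coeffW (Function.update (bOfA a) j (bOfA a j + 1)) -
        coeffU (Function.update (bOfA a) j (bOfA a j + 1)) * coeffW (bOfA a)) := by
  obtain ⟨hbox, hle⟩ := inBox_of_region_converges hconv hreg
  rw [wedgeQ_eq_quadM3' (bOfA a) hbox hd hj (hle _ hj)]
  by_cases h : ∃ k ∈ Icc 1 7, 2 * (bOfA a k + 1) ≤ bOfA a 0 + 1
  · obtain ⟨k, hk, hpart⟩ := h
    rw [← wedgeQ_eq_quadM3' (bOfA a) hbox hd hk (hle _ hk)]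
    exact (wedgeDictionary_holds a k hk hconv hreg hd hpart).1
  · have ha : a = SymRay.aDiag 0 := eq_zero_of_no_partner hreg hd h
    subst ha
    rw [← wedgeQ_eq_quadM3' (bOfA (SymRay.aDiag 0)) hbox hd (show 1 ∈ Icc 1 7 by simp) (hle _ (by simp))]
    exact SymRay.wedgeDictionary_Q_diag 0

/-- **`wedgeDictionary` with the partner condition deleted** (both conjuncts, EVERY `j ∈ [1,7]`): `Q(a) = ρ(UW′ − U′W)` and
`I(a) = 2ρ·[(W′ − 2ζ(2)U′)·F̃₇(b) − (W − 2ζ(2)U)·F̃₇(b′)]`, `b = b(a)`, `b′ = b + e_j`, at every region point of a convergent `a`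
with `d ≥ 0`. [folklore] -/
theorem wedgeDictionary_allPartners :
    ∀ (a : Fin 8 → ℤ) (j : ℕ), j ∈ Icc 1 7 → Converges a →
      (∀ i ∈ Icc 1 7, 0 ≤ bOfA a i ∧ 2 * bOfA a i ≤ bOfA a 0 + 1) → 0 ≤ dOf (bOfA a) →
      (QOf a : ℚ) = rhoOf a * (coeffU (bOfA a) * coeffW (Function.update (bOfA a) j (bOfA a j + 1)) -
          coeffU (Function.update (bOfA a) j (bOfA a j + 1)) * coeffW (bOfA a)) ∧
      cellularIntegral a =
        2 * (rhoOf a : ℝ) *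
          (((coeffW (Function.update (bOfA a) j (bOfA a j + 1)) : ℝ) -
                2 * zetaValue 2 * coeffU (Function.update (bOfA a) j (bOfA a j + 1))) * vwpDual 7 (bOfA a) -
            ((coeffW (bOfA a) : ℝ) - 2 * zetaValue 2 * coeffU (bOfA a)) *
              vwpDual 7 (Function.update (bOfA a) j (bOfA a j + 1))) := by
  intro a j hj hconv hreg hd
  have hQ := wedgeDictionary_Q_allPartners hconv hreg hd hj
  refine ⟨hQ, ?_⟩
  have hI := explicitPQ_allPartners a j hj hconv hreg hd
  obtain ⟨hbox, hle⟩ := inBox_of_region_converges hconv hreg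
  obtain ⟨i, rfl⟩ : ∃ i, j = i + 1 := ⟨j - 1, by have := (mem_Icc.1 hj).1; omega⟩
  have hi : i ∈ range 7 := by have := (mem_Icc.1 hj).2; exact mem_range.2 (by omega)
  obtain ⟨hbox', hsum'⟩ := box_update (bOfA a) hbox hd hi (hle _ hj)
  have h1 := (vwp_decomposition (bOfA a) hbox (sum_le_of_dOf (bOfA a) hd)).2
  have h2 := (vwp_decomposition _ hbox' hsum').2
  have hQ' : ((QOf a : ℤ) : ℝ) = (rhoOf a : ℝ) * ((coeffU (bOfA a) : ℝ) *
      coeffW (Function.update (bOfA a) (i + 1) (bOfA a (i + 1) + 1)) -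
        coeffU (Function.update (bOfA a) (i + 1) (bOfA a (i + 1) + 1)) * coeffW (bOfA a)) := by
    have h := congrArg (fun q : ℚ => (q : ℝ)) hQ
    push_cast at h
    exact h
  rw [hI, h1, h2]
  push_cast
  rw [hQ']
  ring

/-! ## 3. `wedgeDictionaryFull` is its off-half-box residual -/

/-- **The wide-region node `wedgeDictionaryFull` (typer g3: `b_i ≥ 0`, `d ≥ 0`, any partner) is EQUIVALENT to its restriction to the
points OFF the half box** (some `2b_i > b₀ + 1`): on the half box it is `wedgeDictionary_allPartners`.  The residual is NOT proved here.
[folklore] -/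
theorem wedgeDictionaryFull_iff_offHalfBox :
    wedgeDictionaryFull ↔
      ∀ (a : Fin 8 → ℤ) (j : ℕ), j ∈ Icc 1 7 → Converges a → (∀ i ∈ Icc 1 7, 0 ≤ bOfA a i) → 0 ≤ dOf (bOfA a) →
        (∃ i ∈ Icc 1 7, bOfA a 0 + 1 < 2 * bOfA a i) →
        (QOf a : ℚ) = rhoOf a * (coeffU (bOfA a) * coeffW (Function.update (bOfA a) j (bOfA a j + 1)) -
            coeffU (Function.update (bOfA a) j (bOfA a j + 1)) * coeffW (bOfA a)) ∧
        cellularIntegral a =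
          2 * (rhoOf a : ℝ) *
            (((coeffW (Function.update (bOfA a) j (bOfA a j + 1)) : ℝ) -
                  2 * zetaValue 2 * coeffU (Function.update (bOfA a) j (bOfA a j + 1))) * vwpDual 7 (bOfA a) -
              ((coeffW (bOfA a) : ℝ) - 2 * zetaValue 2 * coeffU (bOfA a)) *
                vwpDual 7 (Function.update (bOfA a) j (bOfA a j + 1))) := by
  constructor
  · intro h a j hj hconv hnn hd _
    exact h a j hj hconv hnn hd
  · intro h a j hj hconv hnn hd
    by_cases hoff : ∃ i ∈ Icc 1 7, bOfA a 0 + 1 < 2 * bOfA a i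
    · exact h a j hj hconv hnn hd hoff
    · have hoff' : ∀ i ∈ Icc 1 7, 2 * bOfA a i ≤ bOfA a 0 + 1 := fun i hi => by
        by_contra hc
        exact hoff ⟨i, hi, by omega⟩
      exact wedgeDictionary_allPartners a j hj hconv (fun i hi => ⟨hnn i hi, hoff' i hi⟩) hd

end Summit.KontsevichZagierPeriods.Zeta5Search.WedgeDictionaryAllPartners
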